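import Mathlib.FieldTheory.IsAlgClosed.Basic
import Literature.NumberTheory.EllipticCurves.TwoDescent
import HarnessLib

/-!
# Explicit halving of a point on a curve with rational `2`-torsion, and translation by `2`-torsion

For an elliptic curve `E/F` (`char F = 0`) with rational `2`-torsion `e₁, e₂, e₃`
(`WeierstrassCurve.Affine.SplitTwoTorsion`, the tree's complete `2`-descent file `TwoDescent.lean`,
Silverman, *The Arithmetic of Elliptic Curves*, 2nd ed., Prop. X.1.4 and Thm. X.1.1), the classical
halving formulas (Knapp, *Elliptic Curves*, Thm. 4.2; Silverman AEC X.1, proof of Thm. X.1.1 via the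
functions `x - eᵢ`) are made EXPLICIT, as the algebraic input of the identification of the
cohomological Kummer map `E(F) → H¹(F, E[2])` with the `2`-descent map:

* `nonsingular_halving`: for `P = (x₀, y₀)` and `uᵢ` with `uᵢ² = x₀ - eᵢ`, the point
  `Q = (x₀ + u₁u₂ + u₁u₃ + u₂u₃, (u₁ + u₂)(u₁ + u₃)(u₂ + u₃) - (a₁x(Q) + a₃)/2)` lies on `E`
  (`x(Q) - eᵢ = (uᵢ + uⱼ)(uᵢ + uₖ)`);
* `halving_add_self`: with the signs normalised by `u₁u₂u₃ = y₀ + (a₁x₀ + a₃)/2`, `2Q = P`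
  (the explicit form of the tree's `exists_add_self_eq`, same polynomial certificates);
* `halving_add_twoTorsion₁/₂/₃`: translation by the `2`-torsion points changes the signs of two of
  the `uᵢ`: `Q + T₁ = Q(u₁, -u₂, -u₃)`, `Q + T₂ = Q(-u₁, u₂, -u₃)`, `Q + T₃ = Q(-u₁, -u₂, u₃)`
  (Silverman AEC X.1, proof of X.1.1: a Galois conjugate of a halving point differs from it by the
  `2`-torsion point recording which of the square roots `√(x₀ - eᵢ)` the automorphism negates);
* `SplitTwoTorsion.map`: rational `2`-torsion persists along a field extension (for the geometric
  points `E(F̄)`).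

Everything is proved; no named fact. Deliberate dot-notation extensions of Mathlib's
`WeierstrassCurve.Affine` / `WeierstrassCurve.Affine.Point` namespaces, as in `TwoDescent.lean`.

## References

* [SilvermanAEC2009] J. H. Silverman, *The Arithmetic of Elliptic Curves*, 2nd ed., GTM 106, Springer
  2009, Thm. X.1.1 and Prop. X.1.4 (Complete `2`-descent), pp. 270–271 of the held copy.
* [Knapp1993] A. W. Knapp, *Elliptic Curves*, Mathematical Notes 40, Princeton 1993, Thm. 4.2.
-/

noncomputable section

namespace WeierstrassCurve.Affine

variable {F : Type*} [Field F] {W : Affine F} {e₁ e₂ e₃ : F}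

namespace SplitTwoTorsion

/-- `a₂ = -(e₁ + e₂ + e₃) - a₁²/4` (from `b₂ = a₁² + 4a₂`, Silverman AEC III.§1, and `b₂ = -4(e₁ + e₂ + e₃)`).
[cite: SilvermanAEC2009, III.§1 (p. 42), Prop. X.1.4] -/
lemma a₂_eq' [CharZero F] (h : W.SplitTwoTorsion e₁ e₂ e₃) :
    W.a₂ = -(e₁ + e₂ + e₃) - W.a₁ ^ 2 / 4 := by
  have := h.a₂_eq
  linear_combination (1 / 4 : F) * this

/-- `a₄ = e₁e₂ + e₁e₃ + e₂e₃ - a₁a₃/2` (from `b₄ = 2a₄ + a₁a₃`, Silverman AEC III.§1).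
[cite: SilvermanAEC2009, III.§1 (p. 42), Prop. X.1.4] -/
lemma a₄_eq' [CharZero F] (h : W.SplitTwoTorsion e₁ e₂ e₃) :
    W.a₄ = (e₁ * e₂ + e₁ * e₃ + e₂ * e₃) - W.a₁ * W.a₃ / 2 := by
  have := h.a₄_eq
  linear_combination (1 / 2 : F) * this

/-- `a₆ = -e₁e₂e₃ - a₃²/4` (from `b₆ = a₃² + 4a₆`, Silverman AEC III.§1).
[cite: SilvermanAEC2009, III.§1 (p. 42), Prop. X.1.4] -/
lemma a₆_eq' [CharZero F] (h : W.SplitTwoTorsion e₁ e₂ e₃) :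
    W.a₆ = -(e₁ * e₂ * e₃) - W.a₃ ^ 2 / 4 := by
  have := h.a₆_eq
  linear_combination (1 / 4 : F) * this

/-- **Rational `2`-torsion persists along a field extension** `L/F`: the base-changed curve has
`SplitTwoTorsion (ι e₁) (ι e₂) (ι e₃)`, `ι = algebraMap F L` (the `bᵢ` of `W.baseChange L` are the
images of the `bᵢ` of `W`, Mathlib `map_b₂` / `map_b₄` / `map_b₆`); the hypothesis `E[2] ⊆ E(K)` of
Silverman's complete `2`-descent is stable under extension of the base field.
[cite: SilvermanAEC2009, Prop. X.1.4, III.§1 (p. 42)] -/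
lemma map (h : W.SplitTwoTorsion e₁ e₂ e₃) (L : Type*) [Field L] [Algebra F L] :
    (W.baseChange L).toAffine.SplitTwoTorsion (algebraMap F L e₁) (algebraMap F L e₂)
      (algebraMap F L e₃) := by
  refine ⟨?_, ?_, ?_⟩
  · change (W.map (algebraMap F L)).b₂ = _
    rw [map_b₂, h.b₂_eq]; simp only [map_neg, map_mul, map_add, map_ofNat]
  · change (W.map (algebraMap F L)).b₄ = _
    rw [map_b₄, h.b₄_eq]; simp only [map_mul, map_add, map_ofNat]
  · change (W.map (algebraMap F L)).b₆ = _
    rw [map_b₆, h.b₆_eq]; simp only [map_neg, map_mul, map_ofNat]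

end SplitTwoTorsion

/-! ### The explicit halving point -/

namespace Point

variable [CharZero F]

omit [CharZero F] in
/-- Clearing the denominator in `addX`: `d² x₃ = n² + a₁nd - (a₂ + x₁ + x₂)d²` for `ℓ = n/d`
(the tree's `TwoDescent.sq_mul_addX_div'`, restated since it is private there). [folklore] -/
private lemma sq_mul_addX_div (x₁ x₂ n d : F) (hd : d ≠ 0) :
    d ^ 2 * W.addX x₁ x₂ (n / d) = n ^ 2 + W.a₁ * n * d - (W.a₂ + x₁ + x₂) * d ^ 2 := by
  simp only [addX]
  field_simp
  ring

variable [W.IsElliptic]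

/-- **The explicit halving point lies on the curve.** For `uᵢ` with `uᵢ² = x₀ - eᵢ`, the point
`Q = (x₀ + u₁u₂ + u₁u₃ + u₂u₃, (u₁ + u₂)(u₁ + u₃)(u₂ + u₃) - (a₁x(Q) + a₃)/2)` is a nonsingular point of
`E` (`x(Q) - eᵢ = (uᵢ + uⱼ)(uᵢ + uₖ)`, so `(y(Q) + (a₁x(Q) + a₃)/2)² = ∏ (x(Q) - eᵢ)`); a polynomial
identity. [cite: Knapp1993, Thm. 4.2] -/
theorem nonsingular_halving (h : W.SplitTwoTorsion e₁ e₂ e₃) {x₀ u₁ u₂ u₃ : F}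
    (hu₁ : x₀ - e₁ = u₁ ^ 2) (hu₂ : x₀ - e₂ = u₂ ^ 2) (hu₃ : x₀ - e₃ = u₃ ^ 2) :
    W.Nonsingular (x₀ + u₁ * u₂ + u₁ * u₃ + u₂ * u₃)
      ((u₁ + u₂) * (u₁ + u₃) * (u₂ + u₃) -
        (W.a₁ * (x₀ + u₁ * u₂ + u₁ * u₃ + u₂ * u₃) + W.a₃) / 2) := by
  have hb2' : W.a₁ ^ 2 + 4 * W.a₂ = -4 * ((x₀ - u₁ ^ 2) + (x₀ - u₂ ^ 2) + (x₀ - u₃ ^ 2)) := by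
    rw [h.a₂_eq, ← hu₁, ← hu₂, ← hu₃]; ring
  have hb4' : 2 * W.a₄ + W.a₁ * W.a₃ = 2 * ((x₀ - u₁ ^ 2) * (x₀ - u₂ ^ 2)
      + (x₀ - u₁ ^ 2) * (x₀ - u₃ ^ 2) + (x₀ - u₂ ^ 2) * (x₀ - u₃ ^ 2)) := by
    rw [h.a₄_eq, ← hu₁, ← hu₂, ← hu₃]; ring
  have hb6' : W.a₃ ^ 2 + 4 * W.a₆ = -4 * ((x₀ - u₁ ^ 2) * (x₀ - u₂ ^ 2) * (x₀ - u₃ ^ 2)) := by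
    rw [h.a₆_eq, ← hu₁, ← hu₂, ← hu₃]; ring
  refine equation_iff_nonsingular.mp ?_
  rw [equation_iff]
  linear_combination (- (1 / 4 : F) * u₁ ^ 2 * u₂ ^ 2 - (1 / 2 : F) * u₁ ^ 2 * u₂ * u₃
    - (1 / 4 : F) * u₁ ^ 2 * u₃ ^ 2 - (1 / 2 : F) * u₁ * u₂ ^ 2 * u₃
    - (1 / 2 : F) * u₁ * u₂ * u₃ ^ 2 - (1 / 4 : F) * u₂ ^ 2 * u₃ ^ 2 - (1 / 2 : F) * x₀ * u₁ * u₂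
    - (1 / 2 : F) * x₀ * u₁ * u₃ - (1 / 2 : F) * x₀ * u₂ * u₃ - (1 / 4 : F) * x₀ ^ 2) * hb2'
    + (- (1 / 2 : F) * u₁ * u₂ - (1 / 2 : F) * u₁ * u₃ - (1 / 2 : F) * u₂ * u₃
    - (1 / 2 : F) * x₀) * hb4' + (- (1 / 4 : F)) * hb6'

omit [CharZero F] in
/-- `uᵢ + uⱼ ≠ 0` for `i ≠ j` (else `eᵢ = eⱼ`). [folklore] -/
private lemma add_ne_zero_of_sq_eq (h : W.SplitTwoTorsion e₁ e₂ e₃) {x₀ u₁ u₂ : F}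
    (hu₁ : x₀ - e₁ = u₁ ^ 2) (hu₂ : x₀ - e₂ = u₂ ^ 2) : u₁ + u₂ ≠ 0 := by
  intro huv
  apply h.ne₁₂
  rw [eq_neg_of_add_eq_zero_left huv] at hu₁
  linear_combination hu₂ - hu₁

variable [DecidableEq F]

/-- **`2Q = P` for the explicit halving point** (Knapp, *Elliptic Curves*, Thm. 4.2, constructive
direction; the tree's `exists_add_self_eq` with the point made explicit): if `x₀ - eᵢ = uᵢ²` with the
signs normalised by `y₀ + (a₁x₀ + a₃)/2 = u₁u₂u₃`, then `Q + Q = P`. [cite: Knapp1993, Thm. 4.2] -/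
theorem halving_add_self (h : W.SplitTwoTorsion e₁ e₂ e₃) {x₀ y₀ u₁ u₂ u₃ : F}
    (h₀ : W.Nonsingular x₀ y₀) (hu₁ : x₀ - e₁ = u₁ ^ 2) (hu₂ : x₀ - e₂ = u₂ ^ 2)
    (hu₃ : x₀ - e₃ = u₃ ^ 2) (hy₀ : y₀ + (W.a₁ * x₀ + W.a₃) / 2 = u₁ * u₂ * u₃) :
    some _ _ (nonsingular_halving h hu₁ hu₂ hu₃) + some _ _ (nonsingular_halving h hu₁ hu₂ hu₃) =
      some x₀ y₀ h₀ := by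
  have hb2' : W.a₁ ^ 2 + 4 * W.a₂ = -4 * ((x₀ - u₁ ^ 2) + (x₀ - u₂ ^ 2) + (x₀ - u₃ ^ 2)) := by
    rw [h.a₂_eq, ← hu₁, ← hu₂, ← hu₃]; ring
  have hb4' : 2 * W.a₄ + W.a₁ * W.a₃ = 2 * ((x₀ - u₁ ^ 2) * (x₀ - u₂ ^ 2)
      + (x₀ - u₁ ^ 2) * (x₀ - u₃ ^ 2) + (x₀ - u₂ ^ 2) * (x₀ - u₃ ^ 2)) := by
    rw [h.a₄_eq, ← hu₁, ← hu₂, ← hu₃]; ring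
  have hne : (u₁ + u₂) * (u₁ + u₃) * (u₂ + u₃) ≠ 0 :=
    mul_ne_zero (mul_ne_zero (add_ne_zero_of_sq_eq h hu₁ hu₂)
      (add_ne_zero_of_sq_eq h.swap₂₃ hu₁ hu₃)) (add_ne_zero_of_sq_eq h.swap₁₂.swap₂₃ hu₂ hu₃)
  set x₁ := x₀ + u₁ * u₂ + u₁ * u₃ + u₂ * u₃ with hx₁
  set y₁ := (u₁ + u₂) * (u₁ + u₃) * (u₂ + u₃) - (W.a₁ * x₁ + W.a₃) / 2 with hy₁
  have hy : y₁ ≠ W.negY x₁ y₁ := by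
    intro hyy
    apply hne
    rw [negY, hy₁] at hyy
    linear_combination (1 / 2 : F) * hyy
  have hD : y₁ - W.negY x₁ y₁ ≠ 0 := sub_ne_zero.mpr hy
  rw [add_self_of_Y_ne hy]
  have hX : W.addX x₁ x₁ (W.slope x₁ x₁ y₁ y₁) = x₀ := by
    have key := sq_mul_addX_div (W := W) x₁ x₁ (3 * x₁ ^ 2 + 2 * W.a₂ * x₁ + W.a₄ - W.a₁ * y₁)
      _ hD
    rw [slope_of_Y_ne rfl hy]
    refine mul_left_cancel₀ (pow_ne_zero 2 hD) ?_
    rw [key, negY, hy₁, hx₁]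
    linear_combination (u₁ ^ 3 * u₂ ^ 3 + 5 * u₁ ^ 3 * u₂ ^ 2 * u₃ + 5 * u₁ ^ 3 * u₂ * u₃ ^ 2
      + u₁ ^ 3 * u₃ ^ 3 + 5 * u₁ ^ 2 * u₂ ^ 3 * u₃ + 11 * u₁ ^ 2 * u₂ ^ 2 * u₃ ^ 2
      + (1 / 4 : F) * u₁ ^ 2 * u₂ ^ 2 * W.a₁ ^ 2 + 5 * u₁ ^ 2 * u₂ * u₃ ^ 3
      + (1 / 2 : F) * u₁ ^ 2 * u₂ * u₃ * W.a₁ ^ 2 + (1 / 4 : F) * u₁ ^ 2 * u₃ ^ 2 * W.a₁ ^ 2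
      + 5 * u₁ * u₂ ^ 3 * u₃ ^ 2 + 5 * u₁ * u₂ ^ 2 * u₃ ^ 3
      + (1 / 2 : F) * u₁ * u₂ ^ 2 * u₃ * W.a₁ ^ 2 + (1 / 2 : F) * u₁ * u₂ * u₃ ^ 2 * W.a₁ ^ 2
      + u₂ ^ 3 * u₃ ^ 3 + (1 / 4 : F) * u₂ ^ 2 * u₃ ^ 2 * W.a₁ ^ 2 + 2 * x₀ * u₁ ^ 3 * u₂
      + 2 * x₀ * u₁ ^ 3 * u₃ + 6 * x₀ * u₁ ^ 2 * u₂ ^ 2 + 14 * x₀ * u₁ ^ 2 * u₂ * u₃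
      + 6 * x₀ * u₁ ^ 2 * u₃ ^ 2 + 2 * x₀ * u₁ * u₂ ^ 3 + 14 * x₀ * u₁ * u₂ ^ 2 * u₃
      + 14 * x₀ * u₁ * u₂ * u₃ ^ 2 + (1 / 2 : F) * x₀ * u₁ * u₂ * W.a₁ ^ 2 + 2 * x₀ * u₁ * u₃ ^ 3
      + (1 / 2 : F) * x₀ * u₁ * u₃ * W.a₁ ^ 2 + 2 * x₀ * u₂ ^ 3 * u₃ + 6 * x₀ * u₂ ^ 2 * u₃ ^ 2
      + 2 * x₀ * u₂ * u₃ ^ 3 + (1 / 2 : F) * x₀ * u₂ * u₃ * W.a₁ ^ 2 + u₁ ^ 2 * u₂ ^ 2 * W.a₂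
      + 2 * u₁ ^ 2 * u₂ * u₃ * W.a₂ + u₁ ^ 2 * u₃ ^ 2 * W.a₂ + 2 * u₁ * u₂ ^ 2 * u₃ * W.a₂
      + 2 * u₁ * u₂ * u₃ ^ 2 * W.a₂ + u₂ ^ 2 * u₃ ^ 2 * W.a₂ + x₀ ^ 2 * u₁ ^ 2
      + 3 * x₀ ^ 2 * u₁ * u₂ + 3 * x₀ ^ 2 * u₁ * u₃ + x₀ ^ 2 * u₂ ^ 2 + 3 * x₀ ^ 2 * u₂ * u₃
      + x₀ ^ 2 * u₃ ^ 2 + (1 / 4 : F) * x₀ ^ 2 * W.a₁ ^ 2 + 2 * x₀ * u₁ * u₂ * W.a₂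
      + 2 * x₀ * u₁ * u₃ * W.a₂ + 2 * x₀ * u₂ * u₃ * W.a₂ + (1 / 2 : F) * u₁ * u₂ * W.a₁ * W.a₃
      + (1 / 2 : F) * u₁ * u₃ * W.a₁ * W.a₃ + (1 / 2 : F) * u₂ * u₃ * W.a₁ * W.a₃
      + x₀ ^ 2 * W.a₂ + (1 / 2 : F) * x₀ * W.a₁ * W.a₃ + u₁ * u₂ * W.a₄ + u₁ * u₃ * W.a₄
      + u₂ * u₃ * W.a₄ + x₀ * W.a₄) * hb2'
      + (2 * u₁ ^ 3 * u₂ + 2 * u₁ ^ 3 * u₃ + (7 / 2 : F) * u₁ ^ 2 * u₂ ^ 2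
      + 8 * u₁ ^ 2 * u₂ * u₃ + (7 / 2 : F) * u₁ ^ 2 * u₃ ^ 2 + 2 * u₁ * u₂ ^ 3
      + 8 * u₁ * u₂ ^ 2 * u₃ + 8 * u₁ * u₂ * u₃ ^ 2 + 2 * u₁ * u₃ ^ 3 + 2 * u₂ ^ 3 * u₃
      + (7 / 2 : F) * u₂ ^ 2 * u₃ ^ 2 + 2 * u₂ * u₃ ^ 3 + x₀ * u₁ ^ 2 + x₀ * u₂ ^ 2 + x₀ * u₃ ^ 2
      - (3 / 2 : F) * x₀ ^ 2 + (1 / 4 : F) * W.a₁ * W.a₃ + (1 / 2 : F) * W.a₄) * hb4'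
  have hY : W.addY x₁ x₁ y₁ (W.slope x₁ x₁ y₁ y₁) = y₀ := by
    rw [addY, negAddY, negY, hX, slope_of_Y_ne rfl hy]
    have hl := div_mul_cancel₀ (3 * x₁ ^ 2 + 2 * W.a₂ * x₁ + W.a₄ - W.a₁ * y₁) hD
    set l := (3 * x₁ ^ 2 + 2 * W.a₂ * x₁ + W.a₄ - W.a₁ * y₁) / (y₁ - W.negY x₁ y₁)
    refine mul_left_cancel₀ hD ?_
    rw [negY] at hl ⊢
    rw [hy₁, hx₁] at hl ⊢
    linear_combination (- 2 * u₁ ^ 2 * u₂ - 2 * u₁ ^ 2 * u₃ - 2 * u₁ * u₂ ^ 2 - 4 * u₁ * u₂ * u₃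
      - 2 * u₁ * u₃ ^ 2 - 2 * u₂ ^ 2 * u₃ - 2 * u₂ * u₃ ^ 2) * hy₀
      + ((1 / 2 : F) * u₁ ^ 2 * u₂ ^ 2 + u₁ ^ 2 * u₂ * u₃ + (1 / 2 : F) * u₁ ^ 2 * u₃ ^ 2
      + u₁ * u₂ ^ 2 * u₃ + u₁ * u₂ * u₃ ^ 2 + (1 / 2 : F) * u₂ ^ 2 * u₃ ^ 2
      + (1 / 2 : F) * x₀ * u₁ * u₂ + (1 / 2 : F) * x₀ * u₁ * u₃ + (1 / 2 : F) * x₀ * u₂ * u₃) * hb2'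
      + ((1 / 2 : F) * u₁ * u₂ + (1 / 2 : F) * u₁ * u₃ + (1 / 2 : F) * u₂ * u₃) * hb4'
      - (x₀ - (x₀ + u₁ * u₂ + u₁ * u₃ + u₂ * u₃)) * hl
  simp only [some.injEq]
  exact ⟨hX, hY⟩

/-! ### Translation of the halving point by the `2`-torsion points -/

/-- **`Q + T₁ = Q(u₁, -u₂, -u₃)`**: translating the halving point by `T₁ = (e₁, *)` negates `u₂, u₃`
(Silverman AEC X.1, proof of Thm. X.1.1; the `2`-torsion point `σQ - Q` records the signs
`σ(uᵢ)/uᵢ`). [cite: SilvermanAEC2009, Thm. X.1.1] -/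
theorem halving_add_twoTorsion₁ (h : W.SplitTwoTorsion e₁ e₂ e₃) {x₀ u₁ u₂ u₃ : F}
    (hu₁ : x₀ - e₁ = u₁ ^ 2) (hu₂ : x₀ - e₂ = u₂ ^ 2) (hu₃ : x₀ - e₃ = u₃ ^ 2) :
    some _ _ (nonsingular_halving h hu₁ hu₂ hu₃) + some e₁ _ (nonsingular_twoTorsion h) =
      some _ _ (nonsingular_halving h hu₁ (by rw [hu₂]; ring : x₀ - e₂ = (-u₂) ^ 2)
        (by rw [hu₃]; ring : x₀ - e₃ = (-u₃) ^ 2)) := by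
  have h12 := add_ne_zero_of_sq_eq h hu₁ hu₂
  have h13 := add_ne_zero_of_sq_eq h.swap₂₃ hu₁ hu₃
  have hx : x₀ + u₁ * u₂ + u₁ * u₃ + u₂ * u₃ ≠ e₁ := by
    intro hx
    apply mul_ne_zero h12 h13
    linear_combination hx - hu₁
  have hd : x₀ + u₁ * u₂ + u₁ * u₃ + u₂ * u₃ - e₁ ≠ 0 := sub_ne_zero.mpr hx
  rw [add_of_X_ne hx]
  simp only [some.injEq]
  have ha₂ := h.a₂_eq'
  have he₁ : e₁ = x₀ - u₁ ^ 2 := by linear_combination -hu₁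
  have he₂ : e₂ = x₀ - u₂ ^ 2 := by linear_combination -hu₂
  have he₃ : e₃ = x₀ - u₃ ^ 2 := by linear_combination -hu₃
  have hX : W.addX (x₀ + u₁ * u₂ + u₁ * u₃ + u₂ * u₃) e₁
      (W.slope (x₀ + u₁ * u₂ + u₁ * u₃ + u₂ * u₃) e₁
        ((u₁ + u₂) * (u₁ + u₃) * (u₂ + u₃) -
          (W.a₁ * (x₀ + u₁ * u₂ + u₁ * u₃ + u₂ * u₃) + W.a₃) / 2) (W.twoTorsionY e₁)) =
      x₀ + u₁ * -u₂ + u₁ * -u₃ + -u₂ * -u₃ := by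
    rw [slope_of_X_ne hx]
    have key := sq_mul_addX_div (W := W) (x₀ + u₁ * u₂ + u₁ * u₃ + u₂ * u₃) e₁
      ((u₁ + u₂) * (u₁ + u₃) * (u₂ + u₃) -
          (W.a₁ * (x₀ + u₁ * u₂ + u₁ * u₃ + u₂ * u₃) + W.a₃) / 2 - W.twoTorsionY e₁)
      (x₀ + u₁ * u₂ + u₁ * u₃ + u₂ * u₃ - e₁) hd
    refine mul_left_cancel₀ (pow_ne_zero 2 hd) ?_
    rw [key, ha₂, twoTorsionY, he₁, he₂, he₃]
    ring
  refine ⟨hX, ?_⟩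
  rw [addY, negAddY, negY, hX, slope_of_X_ne hx]
  have hl := div_mul_cancel₀ ((u₁ + u₂) * (u₁ + u₃) * (u₂ + u₃) -
      (W.a₁ * (x₀ + u₁ * u₂ + u₁ * u₃ + u₂ * u₃) + W.a₃) / 2 - W.twoTorsionY e₁) hd
  refine mul_left_cancel₀ hd ?_
  rw [twoTorsionY] at hl ⊢
  rw [he₁] at hl ⊢
  linear_combination (-(x₀ + u₁ * -u₂ + u₁ * -u₃ + -u₂ * -u₃ -
    (x₀ + u₁ * u₂ + u₁ * u₃ + u₂ * u₃))) * hl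


/-- **`Q + T₂ = Q(-u₁, u₂, -u₃)`**: translating the halving point by `T₂ = (e₂, *)` negates `u₁, u₃`.
[cite: SilvermanAEC2009, Thm. X.1.1] -/
theorem halving_add_twoTorsion₂ (h : W.SplitTwoTorsion e₁ e₂ e₃) {x₀ u₁ u₂ u₃ : F}
    (hu₁ : x₀ - e₁ = u₁ ^ 2) (hu₂ : x₀ - e₂ = u₂ ^ 2) (hu₃ : x₀ - e₃ = u₃ ^ 2) :
    some _ _ (nonsingular_halving h hu₁ hu₂ hu₃) + some e₂ _ (nonsingular_twoTorsion h.swap₁₂) =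
      some _ _ (nonsingular_halving h (by rw [hu₁]; ring : x₀ - e₁ = (-u₁) ^ 2) hu₂
        (by rw [hu₃]; ring : x₀ - e₃ = (-u₃) ^ 2)) := by
  have h12 := add_ne_zero_of_sq_eq h hu₁ hu₂
  have h23 := add_ne_zero_of_sq_eq h.swap₁₂.swap₂₃ hu₂ hu₃
  have hx : x₀ + u₁ * u₂ + u₁ * u₃ + u₂ * u₃ ≠ e₂ := by
    intro hx
    apply mul_ne_zero h12 h23
    linear_combination hx - hu₂
  have hd : x₀ + u₁ * u₂ + u₁ * u₃ + u₂ * u₃ - e₂ ≠ 0 := sub_ne_zero.mpr hx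
  rw [add_of_X_ne hx]
  simp only [some.injEq]
  have ha₂ := h.a₂_eq'
  have he₁ : e₁ = x₀ - u₁ ^ 2 := by linear_combination -hu₁
  have he₂ : e₂ = x₀ - u₂ ^ 2 := by linear_combination -hu₂
  have he₃ : e₃ = x₀ - u₃ ^ 2 := by linear_combination -hu₃
  have hX : W.addX (x₀ + u₁ * u₂ + u₁ * u₃ + u₂ * u₃) e₂
      (W.slope (x₀ + u₁ * u₂ + u₁ * u₃ + u₂ * u₃) e₂
        ((u₁ + u₂) * (u₁ + u₃) * (u₂ + u₃) -
          (W.a₁ * (x₀ + u₁ * u₂ + u₁ * u₃ + u₂ * u₃) + W.a₃) / 2) (W.twoTorsionY e₂)) =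
      x₀ + -u₁ * u₂ + -u₁ * -u₃ + u₂ * -u₃ := by
    rw [slope_of_X_ne hx]
    have key := sq_mul_addX_div (W := W) (x₀ + u₁ * u₂ + u₁ * u₃ + u₂ * u₃) e₂
      ((u₁ + u₂) * (u₁ + u₃) * (u₂ + u₃) -
          (W.a₁ * (x₀ + u₁ * u₂ + u₁ * u₃ + u₂ * u₃) + W.a₃) / 2 - W.twoTorsionY e₂)
      (x₀ + u₁ * u₂ + u₁ * u₃ + u₂ * u₃ - e₂) hd
    refine mul_left_cancel₀ (pow_ne_zero 2 hd) ?_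
    rw [key, ha₂, twoTorsionY, he₁, he₂, he₃]
    ring
  refine ⟨hX, ?_⟩
  rw [addY, negAddY, negY, hX, slope_of_X_ne hx]
  have hl := div_mul_cancel₀ ((u₁ + u₂) * (u₁ + u₃) * (u₂ + u₃) -
      (W.a₁ * (x₀ + u₁ * u₂ + u₁ * u₃ + u₂ * u₃) + W.a₃) / 2 - W.twoTorsionY e₂) hd
  refine mul_left_cancel₀ hd ?_
  rw [twoTorsionY] at hl ⊢
  rw [he₂] at hl ⊢
  linear_combination (-(x₀ + -u₁ * u₂ + -u₁ * -u₃ + u₂ * -u₃ -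
    (x₀ + u₁ * u₂ + u₁ * u₃ + u₂ * u₃))) * hl

/-- **`Q + T₃ = Q(-u₁, -u₂, u₃)`**: translating the halving point by `T₃ = (e₃, *)` negates `u₁, u₂`.
[cite: SilvermanAEC2009, Thm. X.1.1] -/
theorem halving_add_twoTorsion₃ (h : W.SplitTwoTorsion e₁ e₂ e₃) {x₀ u₁ u₂ u₃ : F}
    (hu₁ : x₀ - e₁ = u₁ ^ 2) (hu₂ : x₀ - e₂ = u₂ ^ 2) (hu₃ : x₀ - e₃ = u₃ ^ 2) :
    some _ _ (nonsingular_halving h hu₁ hu₂ hu₃) +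
        some e₃ _ (nonsingular_twoTorsion h.swap₂₃.swap₁₂) =
      some _ _ (nonsingular_halving h (by rw [hu₁]; ring : x₀ - e₁ = (-u₁) ^ 2)
        (by rw [hu₂]; ring : x₀ - e₂ = (-u₂) ^ 2) hu₃) := by
  have h13 := add_ne_zero_of_sq_eq h.swap₂₃ hu₁ hu₃
  have h23 := add_ne_zero_of_sq_eq h.swap₁₂.swap₂₃ hu₂ hu₃
  have hx : x₀ + u₁ * u₂ + u₁ * u₃ + u₂ * u₃ ≠ e₃ := by
    intro hx
    apply mul_ne_zero h13 h23
    linear_combination hx - hu₃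
  have hd : x₀ + u₁ * u₂ + u₁ * u₃ + u₂ * u₃ - e₃ ≠ 0 := sub_ne_zero.mpr hx
  rw [add_of_X_ne hx]
  simp only [some.injEq]
  have ha₂ := h.a₂_eq'
  have he₁ : e₁ = x₀ - u₁ ^ 2 := by linear_combination -hu₁
  have he₂ : e₂ = x₀ - u₂ ^ 2 := by linear_combination -hu₂
  have he₃ : e₃ = x₀ - u₃ ^ 2 := by linear_combination -hu₃
  have hX : W.addX (x₀ + u₁ * u₂ + u₁ * u₃ + u₂ * u₃) e₃
      (W.slope (x₀ + u₁ * u₂ + u₁ * u₃ + u₂ * u₃) e₃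
        ((u₁ + u₂) * (u₁ + u₃) * (u₂ + u₃) -
          (W.a₁ * (x₀ + u₁ * u₂ + u₁ * u₃ + u₂ * u₃) + W.a₃) / 2) (W.twoTorsionY e₃)) =
      x₀ + -u₁ * -u₂ + -u₁ * u₃ + -u₂ * u₃ := by
    rw [slope_of_X_ne hx]
    have key := sq_mul_addX_div (W := W) (x₀ + u₁ * u₂ + u₁ * u₃ + u₂ * u₃) e₃
      ((u₁ + u₂) * (u₁ + u₃) * (u₂ + u₃) -
          (W.a₁ * (x₀ + u₁ * u₂ + u₁ * u₃ + u₂ * u₃) + W.a₃) / 2 - W.twoTorsionY e₃)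
      (x₀ + u₁ * u₂ + u₁ * u₃ + u₂ * u₃ - e₃) hd
    refine mul_left_cancel₀ (pow_ne_zero 2 hd) ?_
    rw [key, ha₂, twoTorsionY, he₁, he₂, he₃]
    ring
  refine ⟨hX, ?_⟩
  rw [addY, negAddY, negY, hX, slope_of_X_ne hx]
  have hl := div_mul_cancel₀ ((u₁ + u₂) * (u₁ + u₃) * (u₂ + u₃) -
      (W.a₁ * (x₀ + u₁ * u₂ + u₁ * u₃ + u₂ * u₃) + W.a₃) / 2 - W.twoTorsionY e₃) hd
  refine mul_left_cancel₀ hd ?_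
  rw [twoTorsionY] at hl ⊢
  rw [he₃] at hl ⊢
  linear_combination (-(x₀ + -u₁ * -u₂ + -u₁ * u₃ + -u₂ * u₃ -
    (x₀ + u₁ * u₂ + u₁ * u₃ + u₂ * u₃))) * hl


/-! ### Existence of the square roots over an algebraically closed field -/

omit [DecidableEq F] [W.IsElliptic] in
/-- **Over an algebraically closed field every point has halving data**: for `P = (x₀, y₀) ∈ E(F)`,
`F` algebraically closed, there are `u₁, u₂, u₃ ∈ F` with `uᵢ² = x₀ - eᵢ` and
`u₁u₂u₃ = y₀ + (a₁x₀ + a₃)/2` (choose square roots; `(u₁u₂u₃)² = ∏ (x₀ - eᵢ) = (y₀ + (a₁x₀ + a₃)/2)²`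
by the curve equation, and a sign change of `u₃` fixes the sign). [cite: Knapp1993, Thm. 4.2] -/
theorem exists_halving_roots [IsAlgClosed F] (h : W.SplitTwoTorsion e₁ e₂ e₃) {x₀ y₀ : F}
    (h₀ : W.Equation x₀ y₀) :
    ∃ u₁ u₂ u₃ : F, x₀ - e₁ = u₁ ^ 2 ∧ x₀ - e₂ = u₂ ^ 2 ∧ x₀ - e₃ = u₃ ^ 2 ∧
      y₀ + (W.a₁ * x₀ + W.a₃) / 2 = u₁ * u₂ * u₃ := by
  obtain ⟨u₁, hu₁⟩ := IsAlgClosed.exists_eq_mul_self (x₀ - e₁)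
  obtain ⟨u₂, hu₂⟩ := IsAlgClosed.exists_eq_mul_self (x₀ - e₂)
  obtain ⟨u₃, hu₃⟩ := IsAlgClosed.exists_eq_mul_self (x₀ - e₃)
  have hsq := sq_eq_mul_mul_of_equation h h₀
  have hprod : (y₀ + (W.a₁ * x₀ + W.a₃) / 2) ^ 2 = (u₁ * u₂ * u₃) ^ 2 := by
    rw [hsq, hu₁, hu₂, hu₃]; ring
  rcases sq_eq_sq_iff_eq_or_eq_neg.mp hprod with hy | hy
  · exact ⟨u₁, u₂, u₃, by rw [hu₁]; ring, by rw [hu₂]; ring, by rw [hu₃]; ring, hy⟩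
  · exact ⟨u₁, u₂, -u₃, by rw [hu₁]; ring, by rw [hu₂]; ring, by rw [hu₃]; ring,
      by rw [hy]; ring⟩


/-! ### The addition table of the `2`-torsion points -/

/-- **`T₁ + T₂ = T₃`** for the rational `2`-torsion points `Tᵢ = (eᵢ, -(a₁eᵢ + a₃)/2)`: the chord
through `T₁, T₂` has slope `-a₁/2`, and `addX = a₁²/4 - a₁²/2 - a₂ - e₁ - e₂ = e₃`
(`a₂ = -(e₁ + e₂ + e₃) - a₁²/4`). Silverman AEC III.2.3 / Prop. X.1.4 (`E[2] = {O, T₁, T₂, T₃}` is a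
group of order `4`). [cite: SilvermanAEC2009, Prop. X.1.4, Cor. III.6.4] -/
theorem twoTorsion_add_twoTorsion (h : W.SplitTwoTorsion e₁ e₂ e₃) :
    some e₁ _ (nonsingular_twoTorsion h) + some e₂ _ (nonsingular_twoTorsion h.swap₁₂) =
      some e₃ _ (nonsingular_twoTorsion h.swap₂₃.swap₁₂) := by
  have hx : e₁ ≠ e₂ := h.ne₁₂
  have hd : e₁ - e₂ ≠ 0 := sub_ne_zero.mpr hx
  have hsl : W.slope e₁ e₂ (W.twoTorsionY e₁) (W.twoTorsionY e₂) = -W.a₁ / 2 := by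
    rw [slope_of_X_ne hx, twoTorsionY, twoTorsionY, div_eq_iff hd]
    ring
  rw [add_of_X_ne hx]
  simp only [some.injEq]
  have ha₂ := h.a₂_eq'
  have hX : W.addX e₁ e₂ (W.slope e₁ e₂ (W.twoTorsionY e₁) (W.twoTorsionY e₂)) = e₃ := by
    rw [hsl, addX, ha₂]
    ring
  refine ⟨hX, ?_⟩
  rw [addY, negAddY, negY, hX, hsl, twoTorsionY, twoTorsionY]
  ring

/-- **`T₁ + T₁ = O`**: a rational `2`-torsion point is its own negative (`-T₁ = T₁`, the fixed
point of `y ↦ -y - a₁x - a₃`). [cite: SilvermanAEC2009, Prop. X.1.4, III.2.3] -/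
theorem twoTorsion_add_self (h : W.SplitTwoTorsion e₁ e₂ e₃) :
    some e₁ _ (nonsingular_twoTorsion h) + some e₁ _ (nonsingular_twoTorsion h) = 0 :=
  add_self_of_Y_eq (negY_twoTorsionY e₁).symm

/-- **`2 • T₁ = O`** (integer multiple form). [cite: SilvermanAEC2009, Prop. X.1.4, III.2.3] -/
theorem two_zsmul_twoTorsion (h : W.SplitTwoTorsion e₁ e₂ e₃) :
    (2 : ℤ) • some e₁ _ (nonsingular_twoTorsion h) = 0 := by
  rw [two_zsmul, twoTorsion_add_self h]

end Point

end WeierstrassCurve.Affine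

end
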